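import Literature.NumberTheory.NumberFields.CMFieldCapitulationKernelOddDegree
import Literature.NumberTheory.NumberFields.CMFieldNonPrimaryOfUnramified
import Literature.NumberTheory.QuadraticForms.QuadraticExtensionPlaces
import Literature.NumberTheory.QuadraticFields.SquareRootGenerator
import Mathlib.FieldTheory.Galois.Basic
import Mathlib.NumberTheory.NumberField.Norm
import HarnessLib

/-!
# A non-normal quartic CM field is primary: `K/K⁺` ramifies at some finite prime, `C_{K⁺} → C_K` is
# injective, `Q_K = 1`, `W_K = {±1}`, `E_K = E_{K⁺}` (Louboutin–Okazaki, *Acta Arith.* 67 (1994), §2 (1)–(2), (8))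

Topic `NumberTheory/NumberFields`; namespace `Literature.NumberTheory.NumberFields`.  Theorem-only file (no
definition, no named fact, no `sorry`), unconditional.

> Louboutin–Okazaki, §2: "Let `K` be a non-normal quartic CM-field.  Let `K⁺` be its real quadratic subfield
> and let `δ` be a totally positive element of `A_{K⁺}` such that `K = K⁺(√−δ)`.  Then we have:
> **(1)** The principal ideal `(δ)` of `A_{K⁺}` is not a square in `A_{K⁺}` so that `K/K⁺` is ramified at at
> least one finite prime.  *Proof.* Indeed, if we had `(δ) = I²`, then `N_{K⁺/ℚ}(δ)` that is positive would be
> a square in `ℚ` so that `K/ℚ` would be normal.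
> **(2)** The map `i_{K/K⁺}` is injective from the ideal class group `H(K⁺)` of `K⁺` into the ideal class
> group `H(K)` of `K`."

In the tree's vocabulary (Okazaki's Def. 13 as rendered in `CMFieldCapitulationKernelOddDegree.lean` §7): a CM
field `K` is *non-primary* if `K = K⁺(α)` with `α ∈ 𝓞_K ∖ 0`, `ᾱ = −α`, `δ = −α² ∈ 𝓞_{K⁺}` and `(δ) = 𝔞²`.
We prove:

1. (§1) **the mechanism of (1)**: if a CM field `K` of degree `4` is non-primary then `K/ℚ` is Galois
   (`IsCMField.isGalois_of_nonPrimary_of_finrank_eq_four`).  With `σ` the non-trivial automorphism of the real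
   quadratic field `K⁺` and `δ' = σδ`: `|N_{K⁺/ℚ} δ| = N(𝔞)²` (`Ideal.absNorm`), and `N_{K⁺/ℚ} δ = δδ' > 0`
   because `δ = αᾱ` is totally positive, so `δδ' = m²` with `m ∈ ℕ`; then `β = m/α ∈ K` has `β² = −δ'`, the
   rational polynomial `(X² − d)(X⁴ + (δ+δ')X² + δδ')` (`K⁺ = ℚ(γ)`, `γ² = d`) has the six roots
   `±γ, ±α, ±β` in `K`, which generate `K`, so `K` is its splitting field, hence normal over `ℚ`;
2. (§2) hence **a non-normal quartic CM field is primary** (`IsCMField.not_nonPrimary_of_not_isGalois`), so by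
   Okazaki's Lemma 14 (`CMFieldNonPrimaryOfUnramified.lean`, `CMFieldCapitulationKernelOddDegree.lean` §7):
   **`K/K⁺` ramifies at some finite prime** (`IsCMField.exists_not_isUnramifiedIn_of_not_isGalois`, (1) as
   printed), **`κ_K Q_K = 1`** (`IsCMField.card_ker_mul_indexRealUnits_eq_one_of_not_isGalois`), i.e.
   **`C_{K⁺} → C_K` is injective** (`IsCMField.classGroupExtend_injective_of_not_isGalois`, (2) as printed) and
   **`Q_K = 1`** (`IsCMField.indexRealUnits_eq_one_of_not_isGalois`);
3. (§3) **`W_K = {−1, +1}`** (§2 (2), proof, p. 51: «Since `K/ℚ` is non-normal, the group `W_K` of roots of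
   unity of `K` is `{−1, +1}`»; `IsCMField.torsion_eq_one_or_neg_one_of_not_isGalois`,
   `IsCMField.torsionOrder_eq_two_of_not_isGalois`) — the mechanism being that a quartic CM field with a root of
   unity of order `> 2` is the compositum `K⁺ · ℚ(ζ)` of two normal extensions
   (`IsCMField.isGalois_of_isPrimitiveRoot_of_finrank_eq_four`) — and hence, with `Q_K = 1`, **`E_K = E_{K⁺}`**
   (§2 (8), proof, p. 55: «Since `Q_K = 1` and `W_K = {−1, +1}`, we have `E_K = E_{K⁺}`»;
   `IsCMField.realUnits_eq_top_of_not_isGalois`, `IsCMField.exists_units_algebraMap_eq_of_not_isGalois`,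
   `IsCMField.unitsComplexConj_eq_self_of_not_isGalois`) and **`R_K = 2R_{K⁺}`** (Washington, Prop. 4.16 with
   `Q = 1`; `IsCMField.regulator_eq_two_mul_of_not_isGalois`).

## References

* S. Louboutin, R. Okazaki, *Determination of all non-normal quartic CM-fields and of all non-abelian normal
  octic CM-fields with class number one*, Acta Arith. 67 (1994) 47–62, §2 (1)–(2) (held
  `paper:doi-10-4064-aa-67-1-47-62`, p. 51). [LouboutinOkazaki1994]
* R. Okazaki, *Inclusion of CM-fields and divisibility of relative class numbers*, Acta Arith. 92 (2000), §3
  Def. 13, Lemma 14. [Okazaki2000]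
* L. C. Washington, *Introduction to Cyclotomic Fields*, 2nd ed., GTM 83, Springer (1997), Thm 4.12 (Hasse's
  unit index `Q ∈ {1, 2}`), Prop. 4.16 (`R_K/R_{K⁺} = 2^{r}/Q`). [Washington1997]
-/

noncomputable section

open NumberField NumberField.IsCMField NumberField.Units NumberField.InfinitePlace IsDedekindDomain Polynomial
open Module (finrank)

namespace Literature.NumberTheory.NumberFields

variable (K : Type) [Field K] [NumberField K] [IsCMField K]

/-! ### §1. A non-primary quartic CM field is normal over `ℚ` -/

omit [IsCMField K] in
/-- A real place `w` of a number field `F` and a ring homomorphism `ψ : F →+* ℂ` with real image: `ψ x` is the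
real number `embedding_of_isReal (mk ψ) x`. [folklore] -/
private theorem apply_eq_ofReal_embedding {F : Type*} [Field F] [NumberField F] {ψ : F →+* ℂ}
    (hψ : ComplexEmbedding.IsReal ψ) (x : F) :
    ψ x = ((embedding_of_isReal (isReal_iff.2 (by rwa [embedding_mk_eq_of_isReal hψ])) x : ℝ) : ℂ) := by
  rw [embedding_of_isReal_apply, embedding_mk_eq_of_isReal hψ]

/-- `[K⁺ : ℚ] = 2` for a quartic CM field («let `K⁺` be its real quadratic subfield»).
[cite: LouboutinOkazaki1994, §2 (first sentence)] -/
theorem IsCMField.finrank_maximalRealSubfield_eq_two_of_finrank_eq_four (h4 : finrank ℚ K = 4) :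
    finrank ℚ (maximalRealSubfield K) = 2 := by
  have h := Module.finrank_mul_finrank ℚ (maximalRealSubfield K) K
  rw [h4, Algebra.IsQuadraticExtension.finrank_eq_two (maximalRealSubfield K) K] at h
  omega

/-- **Louboutin–Okazaki §2 (1), the mechanism: a non-primary CM field of degree `4` is normal over `ℚ`.**  If
`K = K⁺(α)`, `α ∈ 𝓞_K ∖ 0`, `ᾱ = −α`, `δ = −α² ∈ 𝓞_{K⁺}` with `(δ) = 𝔞²`, then `N_{K⁺/ℚ}(δ) > 0` is a square
`m²` in `ℚ` (`|N(δ)| = N(𝔞)²`), `β = m/α ∈ K` is a square root of `−δ'` (`δ' = σδ`), and `K` is the splitting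
field of `(X² − d)(X⁴ + (δ + δ')X² + δδ') ∈ ℚ[X]` (`K⁺ = ℚ(√d)`), hence Galois over `ℚ`.
[cite: LouboutinOkazaki1994, §2 (1) (proof)] -/
theorem IsCMField.isGalois_of_nonPrimary_of_finrank_eq_four (h4 : finrank ℚ K = 4) {α : 𝓞 K}
    {δ : 𝓞 (maximalRealSubfield K)} {𝔞 : Ideal (𝓞 (maximalRealSubfield K))} (hα0 : α ≠ 0)
    (hconj : ringOfIntegersComplexConj K α = -α)
    (hδ : algebraMap (𝓞 (maximalRealSubfield K)) (𝓞 K) δ = -(α ^ 2)) (h𝔞 : Ideal.span {δ} = 𝔞 ^ 2) :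
    IsGalois ℚ K := by
  classical
  -- notation: `F = K⁺ = maximalRealSubfield K`, `αK = α ∈ K`, `δF = δ ∈ F`
  have h2F : finrank ℚ (maximalRealSubfield K) = 2 :=
    IsCMField.finrank_maximalRealSubfield_eq_two_of_finrank_eq_four K h4
  haveI : Algebra.IsQuadraticExtension ℚ (maximalRealSubfield K) := { finrank_eq_two' := h2F }
  set αK : K := (α : K) with hαK
  set δF : maximalRealSubfield K := (δ : maximalRealSubfield K) with hδF
  have hαK0 : αK ≠ 0 := by
    rw [hαK]
    exact_mod_cast hα0
  have hαconj : complexConj K αK = -αK := by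
    have h := congrArg (fun y : 𝓞 K => (y : K)) hconj
    rw [coe_ringOfIntegersComplexConj] at h
    simp only [RingOfIntegers.coe_eq_algebraMap, map_neg] at h
    exact h
  have hαsq : αK ^ 2 = algebraMap (maximalRealSubfield K) K (-δF) := by
    have h := congrArg (fun y : 𝓞 K => (y : K)) hδ
    simp only [RingOfIntegers.coe_eq_algebraMap, map_neg, map_pow] at h
    rw [← IsScalarTower.algebraMap_apply,
      IsScalarTower.algebraMap_apply (𝓞 (maximalRealSubfield K)) (maximalRealSubfield K) K] at h
    rw [map_neg, hδF, hαK, RingOfIntegers.coe_eq_algebraMap, RingOfIntegers.coe_eq_algebraMap, h, neg_neg]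
  have hαF : ∀ r : maximalRealSubfield K, algebraMap (maximalRealSubfield K) K r ≠ αK :=
    algebraMap_ne_of_complexConj_eq_neg hαconj hαK0
  have hδF0 : δF ≠ 0 := fun h0 => by
    rw [h0, neg_zero, map_zero, sq_eq_zero_iff] at hαsq
    exact hαK0 hαsq
  -- `δ` is totally positive: `-δ = α²` is totally negative
  have hδpos : ∀ w : InfinitePlace (maximalRealSubfield K),
      0 < embedding_of_isReal (IsTotallyReal.isReal w) δF := fun w => by
    have h := embedding_lt_zero_of_sq_eq hαconj hαK0 hαsq w (IsTotallyReal.isReal w)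
    rw [map_neg] at h
    linarith
  -- the non-trivial automorphism `σ` of `F/ℚ`, `δ' = σ δ`, `T = δ + δ' ∈ ℚ`, `N = δ δ' = N_{F/ℚ} δ ∈ ℚ`
  obtain ⟨σ, hσ⟩ :=
    QuadraticForms.QuadraticExtension.exists_algEquiv_ne_one (K := ℚ) (E := maximalRealSubfield K)
  set δF' : maximalRealSubfield K := σ δF with hδF'
  obtain ⟨T, hT⟩ : ∃ T : ℚ, algebraMap ℚ (maximalRealSubfield K) T = δF + δF' :=
    QuadraticForms.QuadraticExtension.exists_algebraMap_eq_of_fixed hσ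
      (by rw [map_add, hδF', QuadraticForms.QuadraticExtension.algEquiv_algEquiv_apply hσ, add_comm])
  set N : ℚ := Algebra.norm ℚ δF with hN
  have hNprod : algebraMap ℚ (maximalRealSubfield K) N = δF * δF' := by
    rw [hN, Algebra.norm_eq_prod_automorphisms]
    have huniv : (Finset.univ : Finset (maximalRealSubfield K ≃ₐ[ℚ] maximalRealSubfield K)) = {1, σ} := by
      ext τ
      simp only [Finset.mem_univ, Finset.mem_insert, Finset.mem_singleton, true_iff]
      exact QuadraticForms.QuadraticExtension.algEquiv_eq_one_or_eq hσ τ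
    rw [huniv, Finset.prod_pair hσ.symm, AlgEquiv.one_apply]
  -- `N > 0`: apply a real embedding, `δ` and `δ' = σ δ` are positive
  have hNpos : 0 < N := by
    obtain ⟨w₀⟩ : Nonempty (InfinitePlace (maximalRealSubfield K)) := inferInstance
    set φ : maximalRealSubfield K →+* ℂ := w₀.embedding with hφ
    have hφreal : ComplexEmbedding.IsReal φ := isReal_iff.1 (IsTotallyReal.isReal w₀)
    have hψreal : ComplexEmbedding.IsReal (φ.comp σ.toRingEquiv.toRingHom) := by
      rw [ComplexEmbedding.isReal_iff] at hφreal ⊢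
      ext x
      simpa using congrArg (fun f : maximalRealSubfield K →+* ℂ => f (σ x)) hφreal
    obtain ⟨r₁, hr₁, h1⟩ : ∃ r : ℝ, 0 < r ∧ φ δF = r :=
      ⟨embedding_of_isReal (IsTotallyReal.isReal (InfinitePlace.mk φ)) δF, hδpos _,
        apply_eq_ofReal_embedding hφreal δF⟩
    obtain ⟨r₂, hr₂, h2⟩ : ∃ r : ℝ, 0 < r ∧ (φ.comp σ.toRingEquiv.toRingHom) δF = r :=
      ⟨embedding_of_isReal (IsTotallyReal.isReal (InfinitePlace.mk (φ.comp σ.toRingEquiv.toRingHom))) δF,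
        hδpos _, apply_eq_ofReal_embedding hψreal δF⟩
    have h3 : φ (algebraMap ℚ (maximalRealSubfield K) N) = φ δF * (φ.comp σ.toRingEquiv.toRingHom) δF := by
      rw [hNprod, map_mul]
      rfl
    rw [eq_ratCast, map_ratCast, h1, h2, ← Complex.ofReal_mul] at h3
    have h5 : ((N : ℚ) : ℝ) = r₁ * r₂ := by exact_mod_cast h3
    have hpos : (0 : ℝ) < N := by
      rw [h5]
      exact mul_pos hr₁ hr₂
    exact_mod_cast hpos
  -- `|N_ℤ δ| = N(𝔞)²`, so `N = m²`
  set m : ℕ := Ideal.absNorm 𝔞 with hm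
  have hNint : (Algebra.norm ℤ δ).natAbs = m ^ 2 := by
    rw [← Ideal.absNorm_span_singleton, h𝔞, map_pow]
  have hNsq : N = (m : ℚ) ^ 2 := by
    have hcoe : ((Algebra.norm ℤ δ : ℤ) : ℚ) = N := by rw [hN, Algebra.coe_norm_int]
    have hzpos : 0 < Algebra.norm ℤ δ := by exact_mod_cast (hcoe ▸ hNpos : (0 : ℚ) < (Algebra.norm ℤ δ : ℚ))
    have hz : Algebra.norm ℤ δ = (m : ℤ) ^ 2 := by
      rw [← Int.natAbs_of_nonneg hzpos.le, hNint]
      push_cast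
      ring
    rw [← hcoe, hz]
    push_cast
    ring
  -- `β = m/α`, `β² = -δ'`
  set δK : K := algebraMap (maximalRealSubfield K) K δF with hδK
  set δK' : K := algebraMap (maximalRealSubfield K) K δF' with hδK'
  have hδK0 : δK ≠ 0 := (_root_.map_ne_zero _).2 hδF0
  have hαsq' : αK ^ 2 = -δK := by rw [hαsq, map_neg]
  have hprodK : δK * δK' = ((m : ℚ) : K) ^ 2 := by
    rw [hδK, hδK', ← map_mul, ← hNprod, hNsq]
    rw [map_pow, map_pow, ← IsScalarTower.algebraMap_apply, map_natCast, Rat.cast_natCast]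
  set β : K := ((m : ℚ) : K) / αK with hβ
  have hβsq : β ^ 2 = -δK' := by
    rw [hβ, div_pow, ← hprodK, hαsq']
    field_simp
  have hTK : algebraMap ℚ K T = δK + δK' := by
    rw [IsScalarTower.algebraMap_apply ℚ (maximalRealSubfield K) K, hT, map_add]
  have hNK : algebraMap ℚ K N = δK * δK' := by
    rw [IsScalarTower.algebraMap_apply ℚ (maximalRealSubfield K) K, hNprod, map_mul]
  -- a square-root generator `γ` of `F/ℚ`: `γ² = d`
  obtain ⟨γ, d, hγF, hγsq⟩ :=
    QuadraticFields.Quadratic.exists_sq_eq_algebraMap (F := ℚ) (K := maximalRealSubfield K) h2F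
  set γK : K := algebraMap (maximalRealSubfield K) K γ with hγK
  have hγKsq : γK ^ 2 = algebraMap ℚ K d := by
    rw [hγK, ← map_pow, hγsq, ← IsScalarTower.algebraMap_apply]
  -- the rational polynomial `q = (X² - d)(X⁴ + T X² + N)` splits in `K` with roots `±γ, ±α, ±β`
  set q : ℚ[X] := (X ^ 2 - C d) * (X ^ 4 + C T * X ^ 2 + C N) with hq
  have hq2 : (X ^ 2 - C d : ℚ[X]).Monic := monic_X_pow_sub_C d two_ne_zero
  have hq4 : (X ^ 4 + C T * X ^ 2 + C N : ℚ[X]).Monic := by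
    have h : (X ^ 4 + C T * X ^ 2 + C N : ℚ[X]) = X ^ 4 + (C T * X ^ 2 + C N) := by ring
    rw [h]
    refine Monic.add_of_left (monic_X_pow 4) ?_
    refine (degree_add_le _ _).trans_lt ?_
    rw [degree_X_pow, max_lt_iff]
    refine ⟨(degree_C_mul_X_pow_le 2 T).trans_lt (by norm_num), (degree_C_le).trans_lt (by norm_num)⟩
  have hq0 : q ≠ 0 := (hq2.mul hq4).ne_zero
  have hqmap : q.map (algebraMap ℚ K) =
      (X - C γK) * (X + C γK) * ((X - C αK) * (X + C αK) * ((X - C β) * (X + C β))) := by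
    rw [hq, Polynomial.map_mul]
    have e2 : (X ^ 2 - C d : ℚ[X]).map (algebraMap ℚ K) = (X - C γK) * (X + C γK) := by
      simp only [Polynomial.map_sub, Polynomial.map_pow, map_X, map_C, ← hγKsq, C_pow]
      ring
    have e4 : (X ^ 4 + C T * X ^ 2 + C N : ℚ[X]).map (algebraMap ℚ K) =
        (X - C αK) * (X + C αK) * ((X - C β) * (X + C β)) := by
      simp only [Polynomial.map_add, Polynomial.map_mul, Polynomial.map_pow, map_X, map_C, hTK, hNK]
      have e : (X - C αK) * (X + C αK) * ((X - C β) * (X + C β)) =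
          X ^ 4 + C (-(αK ^ 2 + β ^ 2)) * X ^ 2 + C (αK ^ 2 * β ^ 2) := by
        simp only [C_neg, C_add, C_mul, C_pow]
        ring
      rw [e, hαsq', hβsq, show -(-δK + -δK') = δK + δK' by ring, show -δK * -δK' = δK * δK' by ring]
    rw [e2, e4]
  have hsplits : (q.map (algebraMap ℚ K)).Splits := by
    rw [hqmap]
    exact ((Splits.X_sub_C _).mul (Splits.X_add_C _)).mul
      (((Splits.X_sub_C _).mul (Splits.X_add_C _)).mul ((Splits.X_sub_C _).mul (Splits.X_add_C _)))
  -- `γ` and `α` are roots, and they generate `K` over `ℚ`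
  have hrootγ : γK ∈ q.rootSet K := by
    rw [mem_rootSet, ← eval_map_algebraMap, hqmap]
    exact ⟨hq0, by simp⟩
  have hrootα : αK ∈ q.rootSet K := by
    rw [mem_rootSet, ← eval_map_algebraMap, hqmap]
    exact ⟨hq0, by simp⟩
  have hadj : Algebra.adjoin ℚ ({γK, αK} : Set K) = ⊤ := by
    rw [eq_top_iff]
    intro x _
    have h2K : finrank (maximalRealSubfield K) K = 2 :=
      Algebra.IsQuadraticExtension.finrank_eq_two (maximalRealSubfield K) K
    obtain ⟨a, b, hx⟩ := QuadraticFields.Quadratic.exists_eq_add_mul h2K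
      (θ := αK) (by rintro ⟨r, hr⟩; exact hαF r hr) x
    have hmemF : ∀ c : maximalRealSubfield K,
        algebraMap (maximalRealSubfield K) K c ∈ Algebra.adjoin ℚ ({γK, αK} : Set K) := fun c => by
      obtain ⟨p, r, hc⟩ := QuadraticFields.Quadratic.exists_eq_add_mul h2F hγF c
      rw [hc, map_add, map_mul, ← IsScalarTower.algebraMap_apply, ← IsScalarTower.algebraMap_apply]
      exact Subalgebra.add_mem _ (Subalgebra.algebraMap_mem _ p)
        (Subalgebra.mul_mem _ (Subalgebra.algebraMap_mem _ r)
          (Algebra.subset_adjoin (Set.mem_insert _ _)))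
    rw [hx]
    exact Subalgebra.add_mem _ (hmemF a) (Subalgebra.mul_mem _ (hmemF b)
      (Algebra.subset_adjoin (Set.mem_insert_of_mem _ (Set.mem_singleton _))))
  have hadjroot : Algebra.adjoin ℚ (q.rootSet K) = ⊤ := by
    rw [eq_top_iff, ← hadj]
    exact Algebra.adjoin_mono (Set.insert_subset hrootγ (Set.singleton_subset_iff.2 hrootα))
  haveI : IsSplittingField ℚ K q := ⟨hsplits, hadjroot⟩
  haveI : Normal ℚ K := Normal.of_isSplittingField q
  exact isGalois_iff.2 ⟨inferInstance, inferInstance⟩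

/-! ### §2. A non-normal quartic CM field: primary, ramified somewhere, `κ_K = Q_K = 1` -/

/-- **A non-normal quartic CM field is primary** (Louboutin–Okazaki §2 (1): «the principal ideal `(δ)` is not
a square in `A_{K⁺}`», for every presentation `K = K⁺(√−δ)`). [cite: LouboutinOkazaki1994, §2 (1)] -/
theorem IsCMField.not_nonPrimary_of_not_isGalois (h4 : finrank ℚ K = 4) (hK : ¬ IsGalois ℚ K) :
    ¬ ∃ (α : 𝓞 K) (δ : 𝓞 (maximalRealSubfield K)) (𝔞 : Ideal (𝓞 (maximalRealSubfield K))),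
      α ≠ 0 ∧ ringOfIntegersComplexConj K α = -α ∧
        algebraMap (𝓞 (maximalRealSubfield K)) (𝓞 K) δ = -(α ^ 2) ∧ Ideal.span {δ} = 𝔞 ^ 2 := by
  rintro ⟨α, δ, 𝔞, hα0, hconj, hδ, h𝔞⟩
  exact hK (IsCMField.isGalois_of_nonPrimary_of_finrank_eq_four K h4 hα0 hconj hδ h𝔞)

/-- **Louboutin–Okazaki §2 (1): for a non-normal quartic CM field, `K/K⁺` is ramified at at least one finite
prime** (a CM field unramified at every finite prime is non-primary — Okazaki's Lemma 14,
`IsCMField.nonPrimary_of_isUnramifiedIn`). [cite: LouboutinOkazaki1994, §2 (1)] [cite: Okazaki2000, §3 Lemma 14] -/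
theorem IsCMField.exists_not_isUnramifiedIn_of_not_isGalois (h4 : finrank ℚ K = 4) (hK : ¬ IsGalois ℚ K) :
    ∃ v : HeightOneSpectrum (𝓞 (maximalRealSubfield K)), ¬ Algebra.IsUnramifiedIn (𝓞 K) v.asIdeal := by
  by_contra h
  push Not at h
  exact IsCMField.not_nonPrimary_of_not_isGalois K h4 hK (IsCMField.nonPrimary_of_isUnramifiedIn K h)

/-- **For a non-normal quartic CM field, `κ_K Q_K = 1`** (`κ_K Q_K = 2` would make `K` non-primary —
Okazaki's Lemma 14, `IsCMField.exists_sq_eq_neg_of_card_ker_mul_indexRealUnits_eq_two` — while `κ_K Q_K ∣ 2`).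
[cite: LouboutinOkazaki1994, §2 (1)–(2)] [cite: Okazaki2000, §3 Lemma 14] -/
theorem IsCMField.card_ker_mul_indexRealUnits_eq_one_of_not_isGalois (h4 : finrank ℚ K = 4)
    (hK : ¬ IsGalois ℚ K) :
    Nat.card (classGroupExtend (maximalRealSubfield K) K).ker * indexRealUnits K = 1 := by
  have hne2 : Nat.card (classGroupExtend (maximalRealSubfield K) K).ker * indexRealUnits K ≠ 2 := fun h2 =>
    IsCMField.not_nonPrimary_of_not_isGalois K h4 hK
      (IsCMField.exists_sq_eq_neg_of_card_ker_mul_indexRealUnits_eq_two K h2)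
  rcases indexRealUnits_eq_one_or_two K with hQ | hQ
  · rcases card_ker_classGroupExtend_eq_one_or_two K with hκ | hκ
    · rw [hκ, hQ]
    · exact absurd (by rw [hκ, hQ]) hne2
  · have h1 : Nat.card (classGroupExtend (maximalRealSubfield K) K).ker = 1 := by
      rw [(MonoidHom.ker_eq_bot_iff _).mpr (classGroupExtend_injective_of_indexRealUnits_eq_two K hQ),
        Subgroup.card_bot]
    exact absurd (by rw [h1, hQ]) hne2

/-- **Louboutin–Okazaki §2 (2): for a non-normal quartic CM field the map `i_{K/K⁺} : H(K⁺) → H(K)` is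
injective** (`κ_K = 1`). [cite: LouboutinOkazaki1994, §2 (2)] -/
theorem IsCMField.classGroupExtend_injective_of_not_isGalois (h4 : finrank ℚ K = 4) (hK : ¬ IsGalois ℚ K) :
    Function.Injective (classGroupExtend (maximalRealSubfield K) K) := by
  have h1 : Nat.card (classGroupExtend (maximalRealSubfield K) K).ker = 1 :=
    Nat.eq_one_of_mul_eq_one_right (IsCMField.card_ker_mul_indexRealUnits_eq_one_of_not_isGalois K h4 hK)
  rw [← MonoidHom.ker_eq_bot_iff, ← Subgroup.card_eq_one, h1]

/-- **For a non-normal quartic CM field, Hasse's unit index is `Q_K = 1`**: `E_K = W_K E_{K⁺} = ±E_{K⁺}`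
(a unit `ε` with `ε̄ = −ε` would present `K = K⁺(√−η)` with `(η) = (1)` a square).
[cite: LouboutinOkazaki1994, §2 (1)–(2)] [cite: Okazaki2000, §3 Lemma 14] -/
theorem IsCMField.indexRealUnits_eq_one_of_not_isGalois (h4 : finrank ℚ K = 4) (hK : ¬ IsGalois ℚ K) :
    indexRealUnits K = 1 :=
  Nat.eq_one_of_mul_eq_one_left (IsCMField.card_ker_mul_indexRealUnits_eq_one_of_not_isGalois K h4 hK)

/-! ### §3. `W_K = {±1}` and `E_K = E_{K⁺}` for a non-normal quartic CM field (Louboutin–Okazaki §2 (2), (8))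

> §2 (2), proof (p. 51): «Since `K/ℚ` is non-normal, the group `W_K` of roots of unity of `K` is `{−1, +1}`.»
> §2 (8), proof (p. 55): «Since `Q_K = 1` and `W_K = {−1, +1}`, we have `E_K = E_{K⁺}`.» -/

/-- **The mechanism behind `W_K = {±1}`: a quartic CM field containing a root of unity of order `n > 2` is
normal over `ℚ`.**  With `c` the complex conjugation of `K` and `F = K^{⟨c⟩} = K⁺` (`[K : F] = 2`, so
`[F : ℚ] = 2` and `F/ℚ` is normal), a primitive `n`-th root of unity `ζ ∈ K` is not fixed by `c` (`K⁺` is totally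
real and `n > 2`), so `F ⊊ F·ℚ(ζ)`, whence `K = F·ℚ(ζ)` is a compositum of the normal extensions `F/ℚ` and
`ℚ(ζ)/ℚ` (cyclotomic), hence normal. [cite: LouboutinOkazaki1994, §2 (2) (proof: «Since K/ℚ is non-normal, the group W_K of roots of unity of K is {−1, +1}»)] -/
theorem IsCMField.isGalois_of_isPrimitiveRoot_of_finrank_eq_four (h4 : finrank ℚ K = 4) {ζ : K} {n : ℕ}
    (hn : 2 < n) (hζ : IsPrimitiveRoot ζ n) : IsGalois ℚ K := by
  classical
  haveI : NeZero n := ⟨by omega⟩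
  -- complex conjugation as a `ℚ`-automorphism, of order `2`
  set c : K ≃ₐ[ℚ] K := (complexConj K).restrictScalars ℚ with hc_def
  have hc2 : orderOf c = 2 := by
    refine orderOf_eq_prime ?_ ?_
    · ext x
      change complexConj K (complexConj K x) = x
      exact complexConj_apply_apply K x
    · intro h1
      apply complexConj_ne_one K
      ext x
      exact AlgEquiv.congr_fun h1 x
  -- its fixed field `F` (`= K⁺`): `[K : F] = 2`, `[F : ℚ] = 2`, `F/ℚ` normal
  set F : IntermediateField ℚ K := IntermediateField.fixedField (Subgroup.zpowers c) with hF_def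
  have hFK : finrank F K = 2 := by
    rw [hF_def, IntermediateField.finrank_fixedField_eq_card, Nat.card_zpowers, hc2]
  have hF2 : finrank ℚ F = 2 := by
    have h := Module.finrank_mul_finrank ℚ F K
    rw [hFK, h4] at h
    omega
  haveI : Algebra.IsQuadraticExtension ℚ F := { finrank_eq_two' := hF2 }
  -- `E = ℚ(ζ)` is cyclotomic, hence normal
  set E : IntermediateField ℚ K := IntermediateField.adjoin ℚ {ζ} with hE_def
  haveI : IsCyclotomicExtension {n} ℚ E := hζ.intermediateField_adjoin_isCyclotomicExtension ℚ
  haveI : IsGalois ℚ E := IsCyclotomicExtension.isGalois {n} ℚ E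
  -- `ζ ∉ F`: a totally real field has no root of unity of order `> 2`
  have hζF : ζ ∉ F := by
    intro hmem
    have hfix : complexConj K ζ = ζ := by
      have h := (IntermediateField.mem_fixedField_iff (Subgroup.zpowers c) ζ).mp hmem c (Subgroup.mem_zpowers c)
      exact h
    rw [complexConj_eq_self_iff] at hfix
    have hζ' : IsPrimitiveRoot (⟨ζ, hfix⟩ : maximalRealSubfield K) n :=
      IsPrimitiveRoot.of_map_of_injective (f := algebraMap (maximalRealSubfield K) K) (by exact hζ)
        (algebraMap (maximalRealSubfield K) K).injective
    haveI : IsTotallyComplex (maximalRealSubfield K) :=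
      nrRealPlaces_eq_zero_iff.mp (hζ'.nrRealPlaces_eq_zero_of_two_lt hn)
    obtain ⟨w⟩ := (inferInstance : Nonempty (InfinitePlace (maximalRealSubfield K)))
    exact (not_isReal_iff_isComplex.mpr (IsTotallyComplex.isComplex w)) (IsTotallyReal.isReal w)
  -- hence `F ⊔ E = ⊤`
  have hsup : F ⊔ E = ⊤ := by
    have hle : F ≤ F ⊔ E := le_sup_left
    have hζM : ζ ∈ F ⊔ E := (le_sup_right : E ≤ F ⊔ E) (IntermediateField.mem_adjoin_simple_self ℚ ζ)
    have h3 : ¬ finrank ℚ ↥(F ⊔ E) ≤ finrank ℚ F := fun hle' =>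
      hζF (IntermediateField.eq_of_le_of_finrank_le hle hle' ▸ hζM)
    have hmul := Module.finrank_mul_finrank ℚ ↥(F ⊔ E) K
    rw [h4] at hmul
    rw [hF2] at h3
    have hdvd : finrank ℚ ↥(F ⊔ E) ∣ 4 := Dvd.intro _ hmul
    have hle4 : finrank ℚ ↥(F ⊔ E) ≤ 4 := Nat.le_of_dvd (by norm_num) hdvd
    have h4' : finrank ℚ ↥(F ⊔ E) = 4 := by
      interval_cases (finrank ℚ ↥(F ⊔ E)) <;> omega
    exact IntermediateField.eq_of_le_of_finrank_eq le_top (by rw [h4', IntermediateField.finrank_top', h4])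
  -- `F ⊔ E` is normal as a compositum of normal extensions; transport to `K`
  have hNF : Normal ℚ F := Algebra.IsQuadraticExtension.normal ℚ F
  have hNE : Normal ℚ E := inferInstance
  haveI hN : Normal ℚ (⊤ : IntermediateField ℚ K) :=
    hsup ▸ @IntermediateField.normal_sup ℚ K _ _ _ F E (by convert hNF; exact Subsingleton.elim _ _)
      (by convert hNE; exact Subsingleton.elim _ _)
  haveI : Normal ℚ K := Normal.of_algEquiv (h := hN) (IntermediateField.topEquiv (F := ℚ) (E := K))
  exact isGalois_iff.mpr ⟨inferInstance, inferInstance⟩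

set_option backward.isDefEq.respectTransparency false in
/-- **Louboutin–Okazaki §2 (2): `W_K = {−1, +1}` for a non-normal quartic CM field** — every root of unity of
`K` is `±1` (a root of unity of order `> 2` would make `K/ℚ` normal,
`IsCMField.isGalois_of_isPrimitiveRoot_of_finrank_eq_four`). [cite: LouboutinOkazaki1994, §2 (2) (proof, p. 51: «the group W_K of roots of unity of K is {−1, +1}»)] -/
theorem IsCMField.torsion_eq_one_or_neg_one_of_not_isGalois (h4 : finrank ℚ K = 4) (hK : ¬ IsGalois ℚ K)
    (x : torsion K) : (x : (𝓞 K)ˣ) = 1 ∨ (x : (𝓞 K)ˣ) = -1 := by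
  by_cases! hc : 2 < orderOf (x : (𝓞 K)ˣ)
  · rw [← orderOf_units, ← orderOf_submonoid] at hc
    exact absurd (IsCMField.isGalois_of_isPrimitiveRoot_of_finrank_eq_four K h4 hc
      (IsPrimitiveRoot.orderOf (x.1 : K))) hK
  · interval_cases hi : orderOf (x : (𝓞 K)ˣ)
    · linarith [orderOf_pos_iff.2 ((CommGroup.mem_torsion x.1).1 x.2)]
    · exact Or.intro_left _ (orderOf_eq_one_iff.1 hi)
    · rw [← orderOf_units, CharP.orderOf_eq_two_iff 0 (by decide)] at hi
      simp [← Units.val_inj, ← Units.val_inj, Units.val_neg, Units.val_one, hi]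

/-- **`w_K = 2` for a non-normal quartic CM field**: the torsion subgroup of `E_K` has order `2`.
[cite: LouboutinOkazaki1994, §2 (2) (proof, p. 51: «W_K … is {−1, +1}»)] -/
theorem IsCMField.torsionOrder_eq_two_of_not_isGalois (h4 : finrank ℚ K = 4) (hK : ¬ IsGalois ℚ K) :
    torsionOrder K = 2 := by
  classical
  let := Fintype.ofFinite (torsion K)
  rw [torsionOrder, Nat.card_eq_fintype_card]
  refine (Finset.card_eq_two.2 ⟨1, ⟨-1, neg_one_mem_torsion⟩,
    by simp [← Subtype.coe_ne_coe], Finset.ext fun x ↦ ⟨fun _ ↦ ?_, fun _ ↦ Finset.mem_univ _⟩⟩)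
  rw [Finset.mem_insert, Finset.mem_singleton, ← Subtype.val_inj, ← Subtype.val_inj]
  exact IsCMField.torsion_eq_one_or_neg_one_of_not_isGalois K h4 hK x

/-- **Louboutin–Okazaki §2 (8): `E_K = E_{K⁺}` for a non-normal quartic CM field** («Since `Q_K = 1` and
`W_K = {−1, +1}`, we have `E_K = E_{K⁺}`»): the subgroup of `E_K` generated by the units of `K⁺` (Mathlib
`realUnits`) is everything, because `E_K = W_K E_{K⁺}` (`Q_K = 1`, §2) and `W_K = {±1} ⊆ E_{K⁺}`.
[cite: LouboutinOkazaki1994, §2 (8) (proof, p. 55)] -/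
theorem IsCMField.realUnits_eq_top_of_not_isGalois (h4 : finrank ℚ K = 4) (hK : ¬ IsGalois ℚ K) :
    realUnits K = ⊤ := by
  have hQ : (realUnits K ⊔ torsion K).index = 1 := IsCMField.indexRealUnits_eq_one_of_not_isGalois K h4 hK
  have htor : torsion K ≤ realUnits K := by
    intro x hx
    rcases IsCMField.torsion_eq_one_or_neg_one_of_not_isGalois K h4 hK ⟨x, hx⟩ with h | h
    · rw [show x = 1 from h]; exact one_mem _
    · rw [show x = -1 from h, mem_realUnits_iff]
      exact ⟨-1, by simp⟩
  rw [sup_eq_left.mpr htor] at hQ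
  exact Subgroup.index_eq_one.mp hQ

/-- **`E_K = E_{K⁺}`, element form**: every unit of a non-normal quartic CM field `K` is (the image of) a unit of
`K⁺`. [cite: LouboutinOkazaki1994, §2 (8) (proof, p. 55: «E_K = E_{K⁺}»)] -/
theorem IsCMField.exists_units_algebraMap_eq_of_not_isGalois (h4 : finrank ℚ K = 4) (hK : ¬ IsGalois ℚ K)
    (u : (𝓞 K)ˣ) : ∃ v : (𝓞 (maximalRealSubfield K))ˣ, algebraMap (𝓞 (maximalRealSubfield K)) (𝓞 K) v = u :=
  (mem_realUnits_iff K u).mp (by rw [IsCMField.realUnits_eq_top_of_not_isGalois K h4 hK]; exact Subgroup.mem_top u)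

/-- **Every unit of a non-normal quartic CM field is real**: `ū = u` for all `u ∈ E_K`.
[cite: LouboutinOkazaki1994, §2 (8) (proof, p. 55: «E_K = E_{K⁺}»)] -/
theorem IsCMField.unitsComplexConj_eq_self_of_not_isGalois (h4 : finrank ℚ K = 4) (hK : ¬ IsGalois ℚ K)
    (u : (𝓞 K)ˣ) : unitsComplexConj K u = u := by
  rw [unitsComplexConj_eq_self_iff, IsCMField.realUnits_eq_top_of_not_isGalois K h4 hK]
  exact Subgroup.mem_top u

omit [IsCMField K] in
/-- The unit rank of a totally complex quartic field is `1` (`r₁ = 0`, `r₂ = 2`). [cite: Washington1997, Prop. 4.16 (proof: rank E_K = rank E_{K⁺} for a CM field)] -/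
theorem rank_eq_one_of_isTotallyComplex_of_finrank_eq_four [IsTotallyComplex K] (h4 : finrank ℚ K = 4) :
    rank K = 1 := by
  have h1 := card_add_two_mul_card_eq_rank K
  have h2 := card_eq_nrRealPlaces_add_nrComplexPlaces K
  rw [IsTotallyComplex.nrRealPlaces_eq_zero, h4] at h1
  rw [IsTotallyComplex.nrRealPlaces_eq_zero] at h2
  rw [rank, h2]
  omega

/-- **`R_K = 2 R_{K⁺}` for a non-normal quartic CM field**: Washington's `R_K / R_{K⁺} = 2^{r} / Q_K`
(`r = rank E_K = 1`, Mathlib `regulator_div_regulator_eq_two_pow_mul_indexRealUnits_inv`) with `Q_K = 1`.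
[cite: Washington1997, Prop. 4.16] [cite: LouboutinOkazaki1994, §2 (8) (proof, p. 55: Q_K = 1)] -/
theorem IsCMField.regulator_eq_two_mul_of_not_isGalois (h4 : finrank ℚ K = 4) (hK : ¬ IsGalois ℚ K) :
    regulator K = 2 * regulator (maximalRealSubfield K) := by
  have h := regulator_div_regulator_eq_two_pow_mul_indexRealUnits_inv K
  rw [IsCMField.indexRealUnits_eq_one_of_not_isGalois K h4 hK,
    rank_eq_one_of_isTotallyComplex_of_finrank_eq_four K h4, Nat.cast_one, inv_one, mul_one, pow_one,
    div_eq_iff (regulator_pos (maximalRealSubfield K)).ne'] at h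
  exact h

end Literature.NumberTheory.NumberFields

end
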